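import Mathlib
import Literature.NumberTheory.Transcendental.KZSemiCanonicalReductionProofs
import Summits.KontsevichZagierPeriods.KontsevichZagierPeriods.Theorems.SoloInformedVolumeCube
import Summits.KontsevichZagierPeriods.KontsevichZagierPeriods.Theorems.SoloInformedNashImage
import HarnessLib
import HarnessLib.Audit

/-!
# SoloInformed — the cube volume crux follows from Nash cubulation

A purely real-algebraic-geometric statement, with no periods and no KZ moves in it, which implies
the crux `SoloInformedCubeVolumeResolution` of the Ayoub transfer:

`SoloInformedNashCubulation` (conjecture; expected theorem — Hironaka's embedded resolution over
`ℚ` followed by a STRONG Nash triangulation of the resulting compact Nash manifold with corners,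
paper §8.2): every `ℚ`-semialgebraic `K ⊆ [0,1]ᵐ` is, up to a null set, a finite almost-disjoint
union of images `Φᵢ((0,1)ᵐ)` of the open cube under injective `ℚ`-semialgebraic `C¹` maps whose
Jacobians `|det Φᵢ'|` agree on `(0,1)ᵐ` with real parts of cube germs (functions holomorphic near
the closed cube, real on reals, algebraic over `ℚ(z)`). Degenerations of the Jacobian ON the
boundary of the cube (polar-type collapses, power substitutions `(s,t) ↦ (s², t s³)` for cusps)
are allowed.

Main results:
* `soloInformed_presentable_indicator_of_cubulation` — a Nash cubulation of `K` presents
  `[[0,1]ᵐ, 1_K]`: rule (1) over the almost-partition (`KZ.of_sub_sum_of_mem_relations`), the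
  Nash-image lemma on each piece (`soloInformed_presentable_of_nashImage`), sums of presentables;
* `soloInformed_cubeVolumeResolution_of_nashCubulation :
    SoloInformedNashCubulation → SoloInformedCubeVolumeResolution`;
* `soloInformed_ayoubTransfer₈ : SoloInformedSeparationOfPoles → SoloInformedNashCubulation →
    SoloInformedAyoubKZeffQ → KontsevichZagierPeriods`.

References: Kontsevich–Zagier 2001 §1.2; Ayoub 2014 §2.2; Hironaka 1964; Bierstone–Milman 1997;
Shiota 1984 (Publ. RIMS 20) Prop. 6.18; BCR 1998 Prop. 2.2.7, §9.2.
-/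

noncomputable section

open scoped BigOperators
open MeasureTheory Set
open Literature.NumberTheory.Transcendental Literature.NumberTheory.Transcendental.KZ
open Literature.ModelTheory.ExponentialFields (IsSemialgebraic)

namespace Summit.KontsevichZagierPeriods.KontsevichZagierPeriods.Theorems

/-- A **Nash cubulation datum** for a set `K ⊆ ℝᵐ`: finitely many injective `ℚ`-semialgebraic
`C¹` parametrisations of almost-disjoint pieces of `K` by the open cube, covering `K` up to a
null set, whose Jacobians are real parts of cube germs on the open cube. -/
structure SoloInformedCubulation {m : ℕ} (K : Set (Fin m → ℝ)) where
  /-- number of pieces -/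
  k : ℕ
  /-- the parametrisations -/
  Φ : Fin k → (Fin m → ℝ) → (Fin m → ℝ)
  /-- their derivatives on the open cube -/
  Φ' : Fin k → (Fin m → ℝ) → ((Fin m → ℝ) →L[ℝ] (Fin m → ℝ))
  /-- the cube germs giving the Jacobians -/
  G : Fin k → SoloInformedCubeGerm m
  semialgebraic : ∀ i, IsSemialgebraicMapOn ℚ (soloInformedOpenCube m) (Φ i)
  hasFDerivWithinAt : ∀ i, ∀ x ∈ soloInformedOpenCube m,
    HasFDerivWithinAt (Φ i) (Φ' i x) (soloInformedOpenCube m) x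
  injOn : ∀ i, InjOn (Φ i) (soloInformedOpenCube m)
  subset : ∀ i, Φ i '' soloInformedOpenCube m ⊆ K
  almostDisjoint : ∀ i j, i ≠ j →
    volume (Φ i '' soloInformedOpenCube m ∩ Φ j '' soloInformedOpenCube m) = 0
  cover : volume (K \ ⋃ i, Φ i '' soloInformedOpenCube m) = 0
  jacobian : ∀ i, ∀ x ∈ soloInformedOpenCube m,
    ((G i).g (soloInformedToC m x)).re = |(Φ' i x).det|

/-- **Nash cubulation of `ℚ`-semialgebraic sets** (expected theorem; registered as the open
obligation it is in the tree): every `ℚ`-semialgebraic subset of the closed unit cube admits a Nash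
cubulation datum. Route in print: embedded resolution of the boundary hypersurface over `ℚ`
[Hironaka 1964; Bierstone–Milman 1997], then a strong Nash triangulation of the compact Nash
manifold with corners so obtained [Shiota 1984, Prop. 6.18 for the boundary case], simplices
turned into cubes by the monomial map `(s₁, s₁s₂, …)`. -/
@[conjecture] def SoloInformedNashCubulation : Prop :=
  ∀ (m : ℕ) (K : Set (Fin m → ℝ)), IsSemialgebraic ℚ K → K ⊆ soloInformedCube m →
    Nonempty (SoloInformedCubulation K)

/-! ### A cubulation presents the indicator -/

/-- The pieces of a cubulation are `ℚ`-semialgebraic (Tarski–Seidenberg). [BCR 1998, Prop. 2.2.7] -/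
theorem soloInformed_isSemialgebraic_cubPiece {m : ℕ} {K : Set (Fin m → ℝ)}
    (C : SoloInformedCubulation K) (i : Fin C.k) :
    IsSemialgebraic ℚ (C.Φ i '' soloInformedOpenCube m) :=
  IsSemialgebraicMapOn.isSemialgebraic_image_holds (C.semialgebraic i) Subset.rfl
    (isSemialgebraic_soloInformedOpenCube m)

/-- The restriction of the indicator representation `[[0,1]ᵐ, 1_K]` to a piece. -/
def soloInformedPieceRep {m : ℕ} {K : Set (Fin m → ℝ)} (hK : IsSemialgebraic ℚ K)
    (hKc : K ⊆ soloInformedCube m) (C : SoloInformedCubulation K) (i : Fin C.k) : IntegralRep m :=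
  (soloInformedIndicatorRep K hK hKc).restrict (C.Φ i '' soloInformedOpenCube m)
    (soloInformed_isSemialgebraic_cubPiece C i) ((C.subset i).trans hKc)

/-- Each piece of a cubulation is presentable (the Nash-image lemma). -/
theorem soloInformed_presentable_pieceRep {m : ℕ} {K : Set (Fin m → ℝ)} (hK : IsSemialgebraic ℚ K)
    (hKc : K ⊆ soloInformedCube m) (C : SoloInformedCubulation K) (i : Fin C.k) :
    of (soloInformedPieceRep hK hKc C i) ∈ soloInformedPresentable := by
  refine soloInformed_presentable_of_nashImage _ (C.Φ i) (C.Φ' i) (C.G i) (C.semialgebraic i)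
    (C.hasFDerivWithinAt i) (C.injOn i) rfl fun x hx => ?_
  have hmem : C.Φ i x ∈ K := C.subset i (mem_image_of_mem _ hx)
  simp only [soloInformedPieceRep, IntegralRep.integrand_restrict, soloInformedIndicatorRep,
    indicator_of_mem hmem, one_mul]
  exact C.jacobian i x hx

/-- The restriction of the indicator representation to `K` itself. -/
def soloInformedIndicatorRestrict {m : ℕ} {K : Set (Fin m → ℝ)} (hK : IsSemialgebraic ℚ K)
    (hKc : K ⊆ soloInformedCube m) : IntegralRep m :=
  (soloInformedIndicatorRep K hK hKc).restrict K hK hKc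

/-- `[[0,1]ᵐ, 1_K] − [K, 1_K]` is a relation (the integrand vanishes off `K`). -/
theorem soloInformed_indicator_sub_restrict_mem {m : ℕ} {K : Set (Fin m → ℝ)}
    (hK : IsSemialgebraic ℚ K) (hKc : K ⊆ soloInformedCube m) :
    of (soloInformedIndicatorRep K hK hKc) - of (soloInformedIndicatorRestrict hK hKc) ∈
      relations := by
  set I := soloInformedIndicatorRep K hK hKc with hI
  set z : IntegralRep m := I.restrict (soloInformedCube m \ K)
    ((isSemialgebraic_soloInformedCube m).diff hK) Set.sdiff_subset with hz
  have h1 : of I - of (soloInformedIndicatorRestrict hK hKc) - of z ∈ relations := by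
    refine domainAddRel_subset_relations ⟨m, I, soloInformedIndicatorRestrict hK hKc, z, ?_, ?_,
      ?_, ?_, rfl⟩
    · simp [hz, soloInformedIndicatorRestrict, hI, soloInformedIndicatorRep,
        Set.union_sdiff_cancel hKc]
    · simp [hz, soloInformedIndicatorRestrict, Set.inter_sdiff_self]
    · intro x _; rfl
    · intro x _; rfl
  have h2 : of z ∈ relations :=
    soloInformed_of_mem_relations_of_integrand_zero z fun x hx => by
      simp only [hz, IntegralRep.domain_restrict] at hx
      simp [hz, hI, soloInformedIndicatorRep, indicator_of_notMem hx.2]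
  have := relations.add_mem h1 h2
  simpa using this

/-- **A Nash cubulation presents the indicator**: `[[0,1]ᵐ, 1_K]` is presentable whenever `K`
admits a Nash cubulation datum. [Kontsevich–Zagier 2001, §1.2, rules (1)–(2)] -/
theorem soloInformed_presentable_indicator_of_cubulation {m : ℕ} {K : Set (Fin m → ℝ)}
    (hK : IsSemialgebraic ℚ K) (hKc : K ⊆ soloInformedCube m) (C : SoloInformedCubulation K) :
    of (soloInformedIndicatorRep K hK hKc) ∈ soloInformedPresentable := by
  classical
  -- rule (1) over the almost-partition of `K`
  have hsum : of (soloInformedIndicatorRestrict hK hKc) -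
      ∑ i ∈ (Finset.univ : Finset (Fin C.k)), of (soloInformedPieceRep hK hKc C i) ∈ relations := by
    refine of_sub_sum_of_mem_relations Finset.univ (soloInformedIndicatorRestrict hK hKc)
      (fun i => soloInformedPieceRep hK hKc C i) (fun i _ => ?_) (fun i _ => ?_) ?_ ?_
    · simp [soloInformedPieceRep, soloInformedIndicatorRestrict,
        Set.sdiff_eq_empty.2 (C.subset i)]
    · intro x _; rfl
    · simpa [soloInformedIndicatorRestrict, soloInformedPieceRep] using C.cover
    · intro i _ j _ hij
      simpa [soloInformedPieceRep] using C.almostDisjoint i j hij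
  have hP : (∑ i ∈ (Finset.univ : Finset (Fin C.k)), of (soloInformedPieceRep hK hKc C i)) ∈
      soloInformedPresentable :=
    soloInformed_presentable_sum _ _ fun i _ => soloInformed_presentable_pieceRep hK hKc C i
  exact soloInformed_presentable_of_sub_mem (soloInformed_indicator_sub_restrict_mem hK hKc)
    (soloInformed_presentable_of_sub_mem hsum hP)

/-- **Nash cubulation implies the cube volume crux.** -/
theorem soloInformed_cubeVolumeResolution_of_nashCubulation (h : SoloInformedNashCubulation) :
    SoloInformedCubeVolumeResolution := fun m K hK hKc =>
  soloInformed_presentable_indicator_of_cubulation hK hKc (h m K hK hKc).some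

/-- **The Ayoub transfer from Nash cubulation**: separation of poles in dimension `≥ 2`
[Viu-Sos 2021, Cor. 2.2], Nash cubulation of `ℚ`-semialgebraic sets and Ayoub's conjecture up to
torsion [Ayoub 2014, §2.2, Conj. 7, Prop. 11, Rem. 13] imply the Kontsevich–Zagier period
conjecture. -/
theorem soloInformed_ayoubTransfer₈ (H₂ : SoloInformedSeparationOfPoles)
    (hN : SoloInformedNashCubulation) (hA : SoloInformedAyoubKZeffQ) : KontsevichZagierPeriods :=
  soloInformed_ayoubTransfer₇ H₂ (soloInformed_cubeVolumeResolution_of_nashCubulation hN) hA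

end Summit.KontsevichZagierPeriods.KontsevichZagierPeriods.Theorems
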